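import Literature.NumberTheory.EllipticCurves.ZpExtensionGaloisTwistLevel
import Literature.NumberTheory.GaloisRepresentations.ContinuousCupProductCompat
import Literature.NumberTheory.GaloisRepresentations.ContinuousH1ResCocycle
import HarnessLib

/-!
# Change of level for `E[p^J](χ_u)`: the adjunction `⟨ι_* t, y⟩_v = ⟨t, ι^D_* y⟩_v` and the vanishing of
# `π_* = (p^{J−j})_*` on classes that are locally trivial at a place with small twisted invariants (proofs)

Topic `NumberTheory/EllipticCurves`; namespace `WeierstrassCurve`. THEOREMS ONLY (no definition, no named fact,
no instance; D-0026) — proofs file of `ZpExtensionGaloisTwistLevel.lean` (the maps `ι = W.twistedTorsionIncl`,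
`π = W.twistedTorsionMulPow`, `ι^D = W.twistedTorsionInclDual` between the twisted torsion modules
`M_j = E[p^j](χ_u) ⊆ M_J = E[p^J](χ_u)`, `j ≤ J`).

Cell `bsd-2adic`, design memo HOME/t42/DESIGN-T42-ADDENDUM-16/17 §A16.8: in Greenberg's proof of Prop. 4.14/4.15
(LNM 1716 pp. 123–125) the Poitou–Tate obstruction to lifting a LOCAL target `t` of level `j` to a GLOBAL
twisted class lives in the dual Selmer group of the compact module `T^*`; at finite level it is a class
`y ∈ H¹_{𝓕^*}(K, M_J^D)` paired with `ι_* t`, and it is killed in two steps: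

* **(β2) adjunction** `localTatePairingZMod_map_twistedTorsionIncl`: at every place `v`,
  `⟨H¹(ι) t, y⟩_v = ⟨t, H¹(ι^D) y⟩_v` for the local Tate pairings of `M_J` and of `M_j` (both with
  `Hom(·, μ_{p^J})`; adjoint naturality of the cup product, tree `ContPairing.cupProduct_adjoint`,
  Neukirch–Schmidt–Wingberg (1.4.2));
* **(β1)(ii)(iii) vanishing of `π_*`** `map_twistedTorsionMulPow_eq_zero_of_res_eq_zero`: a class
  `y ∈ H¹(Γ_K, M_J)` with `p^{J−j} · y = 0` whose restriction to `Γ_E` VANISHES for some `K`-field `E` (a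
  completion at an omitted prime `v₀`, where the dual condition is STRICT — Greenberg p. 123 «`σ|_{G_{F_{v₀}}}`
  is trivial») and such that the twisted `Γ_E`-invariants of `M_J` are killed by `p^f`, `f ≤ j` (Greenberg
  p. 125 «`H⁰(F_{v₀}, A_{−s})` finite»; the tree's `ZpExtension.finite_setOf_twisted_eigenvector`), has
  `H¹(π) y = 0` in `H¹(Γ_K, M_j)`. Cocycle proof: `p^{J−j} φ = ∂m`, `φ|_{Γ_E} = ∂m₀`, so `m − p^{J−j} m₀` is a
  twisted `Γ_E`-invariant, `p^f (m − p^{J−j} m₀) = 0`, hence `p^j m = 0`, `m = ι m'` and `π ∘ φ = ∂m'`. This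
  replaces the «`H¹(F_Σ/F, T^*)_tors ↪ H¹(F_{v₀}, T^*)_tors`» step of Greenberg's diagram (9) by exponent
  bookkeeping at finite level.

References: R. Greenberg, LNM 1716 (1999), §4 pp. 123–125 [GreenbergLNM1716]; J. Neukirch, A. Schmidt,
K. Wingberg, *Cohomology of Number Fields* (2008), I §4 (1.4.2), I §5 [NeukirchSchmidtWingberg2008];
J.-P. Serre, *Galois Cohomology* (1997), I §2 [SerreGaloisCohomology1997].
-/

noncomputable section

open CategoryTheory Field NumberField
open scoped ContRepresentation

universe u

namespace WeierstrassCurve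

open Literature.NumberTheory.EllipticCurves Literature.NumberTheory.GaloisRepresentations
open Literature.NumberTheory.GaloisRepresentations.DiscreteGaloisModule (TateDual tateDual tateDualEval
  tateDualPairingLocal localTatePairing localTatePairingZMod)

variable {K : Type u} [Field K] (W : WeierstrassCurve K) (p : ℕ) [Fact p.Prime] (κ : ZpExtension K p)
  {j J : ℕ} (hjJ : j ≤ J) (u : ℤ) (hu : (p : ℤ) ∣ u - 1)

/-! ## `ι` and `π` against the twisted actions (element form of the intertwining property) -/

/-- `ι (σ ⋆ Q) = σ ⋆ ι Q` for the twisted actions. [cite: GreenbergLNM1716, §4 p. 105] -/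
theorem twistedTorsionIncl_apply_twist (σ : absoluteGaloisGroup K) (Q : W.geomTorsion ((p ^ j : ℕ) : ℤ)) :
    W.twistedTorsionIncl p κ hjJ u hu (W.twistedTorsionGaloisModule p κ j u hu σ Q) =
      W.twistedTorsionGaloisModule p κ J u hu σ (W.twistedTorsionIncl p κ hjJ u hu Q) :=
  congrArg (fun T ↦ T Q) ((W.twistedTorsionIncl p κ hjJ u hu).isIntertwining' σ)

/-- `π (σ ⋆ P) = σ ⋆ π P` for the twisted actions. [cite: GreenbergLNM1716, §4 p. 123] -/
theorem twistedTorsionMulPow_apply_twist (σ : absoluteGaloisGroup K) (P : W.geomTorsion ((p ^ J : ℕ) : ℤ)) :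
    W.twistedTorsionMulPow p κ hjJ u hu (W.twistedTorsionGaloisModule p κ J u hu σ P) =
      W.twistedTorsionGaloisModule p κ j u hu σ (W.twistedTorsionMulPow p κ hjJ u hu P) :=
  congrArg (fun T ↦ T P) ((W.twistedTorsionMulPow p κ hjJ u hu).isIntertwining' σ)

/-! ## (β1)(ii)(iii): `π_* y = 0` for `p^{J−j} y = 0`, `y` locally trivial where the twisted invariants are small -/

/-- **Vanishing of `π_* = H¹(p^{J−j})` on classes killed by `p^{J−j}` that are locally trivial at a place whose
twisted invariants are killed by `p^f`, `f ≤ j`** (finite-level form of Greenberg's «an element `σ` in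
`S'_{T^*}(F)` is in `H¹(F_Σ/F, T^*)_tors` and has `σ|_{G_{F_{v₀}}}` trivial … Hence `σ` is trivial», LNM 1716
p. 123, with p. 125 «`H⁰(F_{v₀}, M^*)` finite»). For a `K`-field `E` (a completion), if every point of
`E[p^J]` fixed by the twisted action of `Γ_E` is killed by `p^f` with `f ≤ j ≤ J`, then every
`y ∈ H¹(Γ_K, E[p^J](χ_u))` with `p^{J−j} · y = 0` and `res_{Γ_E} y = 0` satisfies `H¹(π) y = 0` in
`H¹(Γ_K, E[p^j](χ_u))`. [cite: GreenbergLNM1716, §4 pp. 123–125] [cite: SerreGaloisCohomology1997, I §2.2] -/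
theorem map_twistedTorsionMulPow_eq_zero_of_res_eq_zero {E : Type u} [Field E] [Algebra K E] {f : ℕ}
    (hfj : f ≤ j)
    (hinv : ∀ P : W.geomTorsion ((p ^ J : ℕ) : ℤ),
      (∀ σ : absoluteGaloisGroup E,
        W.twistedTorsionGaloisModule p κ J u hu (absGaloisRestrict K E σ) P = P) →
      ((p ^ f : ℕ) : ℤ) • P = 0)
    (y : galoisCohomology (W.twistedTorsionGaloisModule p κ J u hu) 1)
    (hy : (p ^ (J - j)) • y = 0)
    (hloc : galoisCohomology.res (W.twistedTorsionGaloisModule p κ J u hu) E 1 y = 0) :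
    galoisCohomology.map (W.twistedTorsionMulPow p κ hjJ u hu) 1 y = 0 := by
  obtain ⟨φ, rfl⟩ := oneCocycleClass_surjective _ y
  -- `p^{J-j} φ = ∂m`
  have hs := oneCocycleClass_smul (W.twistedTorsionGaloisModule p κ J u hu).toTopRep
    ((p ^ (J - j) : ℕ) : ℤ) φ
  conv at hs => rhs; rw [Nat.cast_smul_eq_nsmul]
  have hy' : oneCocycleClass (W.twistedTorsionGaloisModule p κ J u hu).toTopRep
      (((p ^ (J - j) : ℕ) : ℤ) • φ) = 0 := hs.trans hy
  rw [oneCocycleClass_eq_zero_iff] at hy'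
  obtain ⟨m, hm⟩ := hy'
  have hm' : ∀ g : absoluteGaloisGroup K, ((p ^ (J - j) : ℕ) : ℤ) • φ.1 g =
      W.twistedTorsionGaloisModule p κ J u hu g m - m := fun g ↦ hm g
  -- `φ|_{Γ_E} = ∂m₀`
  rw [galoisCohomology.res_one_oneCocycleClass] at hloc
  obtain ⟨m₀, hm₀⟩ := (oneCocycleClass_eq_zero_iff _ _).mp hloc
  have hm₀' : ∀ σ : absoluteGaloisGroup E, φ.1 (absGaloisRestrict K E σ) =
      W.twistedTorsionGaloisModule p κ J u hu (absGaloisRestrict K E σ) m₀ - m₀ := fun σ ↦ hm₀ σ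
  -- `m - p^{J-j} m₀` is a twisted `Γ_E`-invariant, hence killed by `p^f`
  have hfix : ∀ σ : absoluteGaloisGroup E,
      W.twistedTorsionGaloisModule p κ J u hu (absGaloisRestrict K E σ) (m - ((p ^ (J - j) : ℕ) : ℤ) • m₀) =
        m - ((p ^ (J - j) : ℕ) : ℤ) • m₀ := fun σ ↦ by
    have h1 := hm' (absGaloisRestrict K E σ)
    rw [hm₀' σ, smul_sub] at h1
    have h2 : W.twistedTorsionGaloisModule p κ J u hu (absGaloisRestrict K E σ) m =
        ((p ^ (J - j) : ℕ) : ℤ) • W.twistedTorsionGaloisModule p κ J u hu (absGaloisRestrict K E σ) m₀ -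
          ((p ^ (J - j) : ℕ) : ℤ) • m₀ + m := by
      rw [h1, sub_add_cancel]
    rw [map_sub, map_zsmul, h2]
    abel
  have hkill : ((p ^ f : ℕ) : ℤ) • (m - ((p ^ (J - j) : ℕ) : ℤ) • m₀) = 0 := hinv _ hfix
  -- hence `p^j m = 0`
  have hjm : ((p ^ j : ℕ) : ℤ) • m = 0 := by
    obtain ⟨k, hk⟩ := Nat.exists_eq_add_of_le hfj
    have hjk : ((p ^ j : ℕ) : ℤ) = ((p ^ k : ℕ) : ℤ) * ((p ^ f : ℕ) : ℤ) := by
      rw [hk, pow_add, Nat.cast_mul, mul_comm]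
    have hJ : ((p ^ j : ℕ) : ℤ) * ((p ^ (J - j) : ℕ) : ℤ) = ((p ^ J : ℕ) : ℤ) := by
      rw [← Nat.cast_mul, ← pow_add, Nat.add_sub_cancel' hjJ]
    have h1 : ((p ^ j : ℕ) : ℤ) • (m - ((p ^ (J - j) : ℕ) : ℤ) • m₀) = 0 := by
      rw [hjk, mul_smul, hkill, smul_zero]
    have h2 : ((p ^ j : ℕ) : ℤ) • (((p ^ (J - j) : ℕ) : ℤ) • m₀) = 0 := by
      rw [smul_smul, hJ, natCast_zsmul]
      exact W.pow_nsmul_geomTorsion_pow p J m₀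
    rw [smul_sub, h2, sub_zero] at h1
    exact h1
  -- so `m = ι m'`
  obtain ⟨m', hm'ι⟩ := W.exists_twistedTorsionIncl_eq_of_smul_eq_zero p κ hjJ u hu m hjm
  -- and `π ∘ φ = ∂m'`
  rw [galoisCohomology.map_one_oneCocycleClass]
  refine (oneCocycleClass_eq_zero_iff _ _).mpr ⟨m', fun g ↦ W.twistedTorsionIncl_injective p κ hjJ u hu ?_⟩
  change W.twistedTorsionIncl p κ hjJ u hu (W.twistedTorsionMulPow p κ hjJ u hu (φ.1 g)) =
    W.twistedTorsionIncl p κ hjJ u hu (W.twistedTorsionGaloisModule p κ j u hu g m' - m')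
  rw [twistedTorsionIncl_mulPow, map_sub, twistedTorsionIncl_apply_twist, hm'ι]
  exact hm' g

/-! ## (β2): the adjunction `⟨ι_* t, y⟩_v = ⟨t, ι^D_* y⟩_v` of the local Tate pairings -/

section Adjunction

variable [NumberField K] [Finite (W.geomTorsion ((p ^ j : ℕ) : ℤ))] [Finite (W.geomTorsion ((p ^ J : ℕ) : ℤ))]

/-- **`⟨H¹(ι) t, y⟩_v = ⟨t, H¹(ι^D) y⟩_v`**: at every place `v` of the number field `K` and for every additive
`inv_v : H²(K_v, μ_{p^J}) → ℤ/p^J`, the local Tate pairing of `M_J = E[p^J](χ_u)` evaluated on the image of a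
level-`j` class `t ∈ H¹(K_v, M_j)` equals the local Tate pairing of `M_j` (with `M_j^D = Hom(M_j, μ_{p^J})`)
of `t` with `H¹(ι^D) y` — adjoint naturality of the cup product for `ev_J(ι x, f) = ev_j(x, ι^D f)`.
[cite: NeukirchSchmidtWingberg2008, I §4 (1.4.2)] [cite: MilneADT2006, Ch. I, Cor. 2.3] -/
theorem localTatePairingZMod_map_twistedTorsionIncl (v : Place K)
    (inv : galoisCohomology ((DiscreteGaloisModule.mu K (p ^ J)).toLocal v) 2 →+ ZMod (p ^ J))
    (t : galoisCohomology ((W.twistedTorsionGaloisModule p κ j u hu).toLocal v) 1)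
    (y : galoisCohomology (((W.twistedTorsionGaloisModule p κ J u hu).tateDual (p ^ J)).toLocal v) 1) :
    localTatePairingZMod (W.twistedTorsionGaloisModule p κ J u hu) (p ^ J) v inv
        (galoisCohomology.map ((W.twistedTorsionIncl p κ hjJ u hu).restrictField (Place.Completion v)) 1 t)
        y =
      localTatePairingZMod (W.twistedTorsionGaloisModule p κ j u hu) (p ^ J) v inv t
        (galoisCohomology.map ((W.twistedTorsionInclDual p κ hjJ u hu).restrictField (Place.Completion v))
          1 y) := by
  haveI := absoluteGaloisGroup_compactSpace (Place.Completion (K := K) v)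
  rw [DiscreteGaloisModule.localTatePairingZMod_apply, DiscreteGaloisModule.localTatePairingZMod_apply]
  congr 1
  exact ContPairing.cupProduct_adjoint
    (tateDualPairingLocal (W.twistedTorsionGaloisModule p κ j u hu) (p ^ J) v)
    (tateDualPairingLocal (W.twistedTorsionGaloisModule p κ J u hu) (p ^ J) v)
    (TopRep.ofHom ⟨((W.twistedTorsionIncl p κ hjJ u hu).restrictField (Place.Completion v)).toContinuousLinearMap,
      ((W.twistedTorsionIncl p κ hjJ u hu).restrictField (Place.Completion v)).isIntertwining'⟩)
    (TopRep.ofHom ⟨((W.twistedTorsionInclDual p κ hjJ u hu).restrictField (Place.Completion v)).toContinuousLinearMap,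
      ((W.twistedTorsionInclDual p κ hjJ u hu).restrictField (Place.Completion v)).isIntertwining'⟩)
    (fun _ _ ↦ rfl) t y

end Adjunction

end WeierstrassCurve

end
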